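import Summits.AtomisticToContinuum.BoseEinsteinCondensation.Theorems.BECProbeMassFlowCloudMomentumAtomClusteringReduction
import Literature.MathematicalPhysics.QuantumManyBody.PeriodicClusteringFromKyFanGap
import Literature.MathematicalPhysics.QuantumManyBody.PeriodicBoseGasImpurity
import Literature.MathematicalPhysics.QuantumManyBody.PeriodicKyFanGapRayleigh
import Literature.MathematicalPhysics.QuantumManyBody.DiluteBoseGasUpperBoundLocalization
import HarnessLib

/-!
# Clustering of pinned near-minimisers from a Ky Fan gap of the pinned form (stub C1)

Helper file for the crux `BECProbeMassFlow.CloudMomentumAtom` (item stmt-AtomisticToContinuum-12310),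
line `registered`, stub `stub_impurityClustering_of_gap` of the reshaped skeleton (lead c2).

The pinned-scatterer form `impurityPeriodicEnergy v 0 Φ = periodicEnergy v Φ + ∫⁻_{cell^N} V₀ |Φ|²`,
`V₀(X) = ∑ⱼ v^per(xⱼ - 0)`, differs from the free periodic form by a ONE-BODY weight. The
parallelogram-law argument of the tree's `exists_phase_integral_norm_sub_sq_le_of_kyFanGap`
(`PeriodicClusteringFromKyFanGap.lean`) only uses that the form is a nonnegative quadratic functional of
the wave function obeying the parallelogram law `q(φ+ψ) + q(φ-ψ) = 2q(φ) + 2q(ψ)` and the scaling law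
`q(cψ) = |c|² q(ψ)`; the weighted term `∫⁻ W |·|²` obeys both for every measurable weight
`W : Config N → [0, ∞]` (`lintegral_weight_sq_add_add_sub`, `lintegral_weight_sq_const_mul`). We run
the argument for the WEIGHTED form `periodicEnergy v Ψ + ∫⁻ W |Ψ|²` with an abstract finite floor `E`
(variational principle as a hypothesis) and an abstract Ky Fan gap `2E + γ ≤ q_W(Φ₁) + q_W(Φ₂)` on
`L²(cell)`-orthogonal trial pairs (`exists_phase_of_weighted_kyFanGap`, modulus `δ = γη/16`), then
specialise to `W = V₀`, `E = impurityPeriodicGroundStateEnergy v N L 0` and read the phase-closeness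
`∫ |Φ - e^{iθ}Φ'|² ≤ η` as the overlap bound `|⟨Φ, Φ'⟩|² ≥ 1 - η`
(`ofReal_le_sq_nnnorm_integral_of_phase` of the landed reduction module).
-/

noncomputable section

open MeasureTheory Filter
open scoped ENNReal NNReal ComplexConjugate BigOperators InnerProductSpace

namespace Summit.AtomisticToContinuum.BoseEinsteinCondensation.Cruxes.CloudMomentumAtom.Birth

open Literature.MathematicalPhysics.QuantumManyBody.BoseGas

variable {N : ℕ} {L : ℝ} {v : ℝ → ℝ≥0∞}

/-! ### Parallelogram and scaling laws for a weighted cell norm -/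

/-- **Parallelogram law for a weighted cell norm**: `∫ W|φ+ψ|² + ∫ W|φ-ψ|² = 2∫ W|φ|² + 2∫ W|ψ|²`
(measurable weight `W ≥ 0`, possibly infinite; continuous `φ, ψ`). [folklore] -/
theorem lintegral_weight_sq_add_add_sub {W : Config N → ℝ≥0∞} (hW : Measurable W) (L : ℝ)
    {φ ψ : Config N → ℂ} (hφ : Continuous φ) (hψ : Continuous ψ) :
    (∫⁻ X in cellN N L, W X * ((‖φ X + ψ X‖₊ : ℝ≥0∞)) ^ 2) +
      (∫⁻ X in cellN N L, W X * ((‖φ X - ψ X‖₊ : ℝ≥0∞)) ^ 2) =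
    2 * (∫⁻ X in cellN N L, W X * ((‖φ X‖₊ : ℝ≥0∞)) ^ 2) +
      2 * (∫⁻ X in cellN N L, W X * ((‖ψ X‖₊ : ℝ≥0∞)) ^ 2) := by
  have H : ∫⁻ X in cellN N L, (W X * ((‖φ X + ψ X‖₊ : ℝ≥0∞)) ^ 2 +
        W X * ((‖φ X - ψ X‖₊ : ℝ≥0∞)) ^ 2) =
      ∫⁻ X in cellN N L, (2 * (W X * ((‖φ X‖₊ : ℝ≥0∞)) ^ 2) +
        2 * (W X * ((‖ψ X‖₊ : ℝ≥0∞)) ^ 2)) := by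
    refine lintegral_congr fun X => ?_
    rw [← mul_add, ennreal_sq_nnnorm_add_add_sub]
    ring
  rw [lintegral_add_left
      (hW.fun_mul (measurable_coe_nnnorm_sq (χ := fun Y => φ Y + ψ Y) (hφ.add hψ))),
    lintegral_add_left ((hW.fun_mul (measurable_coe_nnnorm_sq hφ)).const_mul 2),
    lintegral_const_mul _ (hW.fun_mul (measurable_coe_nnnorm_sq hφ)),
    lintegral_const_mul _ (hW.fun_mul (measurable_coe_nnnorm_sq hψ))] at H
  exact H

/-- **Scaling law for a weighted cell norm**: `∫ W|cψ|² = |c|² ∫ W|ψ|²`. [folklore] -/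
theorem lintegral_weight_sq_const_mul (W : Config N → ℝ≥0∞) (L : ℝ) (c : ℂ) (ψ : Config N → ℂ) :
    ∫⁻ X in cellN N L, W X * ((‖c * ψ X‖₊ : ℝ≥0∞)) ^ 2 =
      ((‖c‖₊ : ℝ≥0∞)) ^ 2 * ∫⁻ X in cellN N L, W X * ((‖ψ X‖₊ : ℝ≥0∞)) ^ 2 := by
  rw [← lintegral_const_mul' _ _ (ENNReal.pow_ne_top ENNReal.coe_ne_top)]
  refine lintegral_congr fun X => ?_
  rw [nnnorm_mul, ENNReal.coe_mul, mul_pow]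
  ring

/-- **Parallelogram law for the weighted periodic energy** `q_W(χ) = ∫ (|∇χ|² + ∑_{i<j}v^per|χ|²) + ∫ W|χ|²`
of `C¹` functions: `q_W(φ+ψ) + q_W(φ-ψ) = 2q_W(φ) + 2q_W(ψ)` (measurable `v`, `W`; hard cores and
infinite weights included). [folklore] -/
theorem lintegral_weightedEnergy_add_add_sub (hv : Measurable v) {W : Config N → ℝ≥0∞}
    (hW : Measurable W) (L : ℝ) {φ ψ : Config N → ℂ} (hφ : ContDiff ℝ 1 φ) (hψ : ContDiff ℝ 1 ψ) :
    ((∫⁻ X in cellN N L, kineticDensity (fun Y => φ Y + ψ Y) X +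
        periodicInteraction v L X * ((‖φ X + ψ X‖₊ : ℝ≥0∞)) ^ 2) +
      ∫⁻ X in cellN N L, W X * ((‖φ X + ψ X‖₊ : ℝ≥0∞)) ^ 2) +
    ((∫⁻ X in cellN N L, kineticDensity (fun Y => φ Y - ψ Y) X +
        periodicInteraction v L X * ((‖φ X - ψ X‖₊ : ℝ≥0∞)) ^ 2) +
      ∫⁻ X in cellN N L, W X * ((‖φ X - ψ X‖₊ : ℝ≥0∞)) ^ 2) =
    2 * ((∫⁻ X in cellN N L, kineticDensity φ X +
        periodicInteraction v L X * ((‖φ X‖₊ : ℝ≥0∞)) ^ 2) +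
      ∫⁻ X in cellN N L, W X * ((‖φ X‖₊ : ℝ≥0∞)) ^ 2) +
    2 * ((∫⁻ X in cellN N L, kineticDensity ψ X +
        periodicInteraction v L X * ((‖ψ X‖₊ : ℝ≥0∞)) ^ 2) +
      ∫⁻ X in cellN N L, W X * ((‖ψ X‖₊ : ℝ≥0∞)) ^ 2) := by
  have h1 := lintegral_periodicEnergy_add_add_sub hv L hφ hψ
  have h2 := lintegral_weight_sq_add_add_sub hW L hφ.continuous hψ.continuous
  calc _ = ((∫⁻ X in cellN N L, kineticDensity (fun Y => φ Y + ψ Y) X +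
          periodicInteraction v L X * ((‖φ X + ψ X‖₊ : ℝ≥0∞)) ^ 2) +
        (∫⁻ X in cellN N L, kineticDensity (fun Y => φ Y - ψ Y) X +
          periodicInteraction v L X * ((‖φ X - ψ X‖₊ : ℝ≥0∞)) ^ 2)) +
        ((∫⁻ X in cellN N L, W X * ((‖φ X + ψ X‖₊ : ℝ≥0∞)) ^ 2) +
          (∫⁻ X in cellN N L, W X * ((‖φ X - ψ X‖₊ : ℝ≥0∞)) ^ 2)) := by ring
    _ = _ := by rw [h1, h2]; ring

/-! ### Clustering from a Ky Fan gap of a weighted form -/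

/-- **Clustering of near-minimisers of a weighted periodic form from a Ky Fan gap** (all measurable
`v` and `W`, all `N`, `L`). Let `q_W(Ψ) = periodicEnergy v Ψ + ∫_{cell^N} W|Ψ|²`, let `E < ∞` be a
lower bound of `q_W` on periodic trial states, and suppose the Ky Fan gap
`2E + γ ≤ q_W(Φ₁) + q_W(Φ₂)` for every `L²(cell^N)`-orthogonal pair of trial states, `γ > 0`. Then any
two trial states with `q_W ≤ E + γη/16` satisfy `∫_{cell^N} |Φ - e^{iθ}Φ'|² ≤ η` for some phase `θ`
(`θ = arg⟨Φ',Φ⟩` or `+ π`). Proof: the parallelogram law for `q_W` on the orthogonal pair `Φ ± e^{iθ}Φ'`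
and the gap tested on its normalisation, as in `exists_phase_integral_norm_sub_sq_le_of_kyFanGap`.
[cite: ReedSimonIV1978, Thm XIII.1–2 (min–max for the two lowest levels; Ky Fan form)] -/
theorem exists_phase_of_weighted_kyFanGap (hv : Measurable v) {W : Config N → ℝ≥0∞}
    (hW : Measurable W) {E : ℝ≥0∞} (hE : E ≠ ⊤) {γ : ℝ} (hγ : 0 < γ)
    (hvar : ∀ Ψ : PeriodicTrialState N L,
      E ≤ periodicEnergy v Ψ + ∫⁻ X in cellN N L, W X * ((‖Ψ.ψ X‖₊ : ℝ≥0∞)) ^ 2)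
    (hgap : ∀ Φ₁ Φ₂ : PeriodicTrialState N L,
      ∫ X in cellN N L, conj (Φ₁.ψ X) * Φ₂.ψ X = 0 →
      2 * E + ENNReal.ofReal γ ≤
        (periodicEnergy v Φ₁ + ∫⁻ X in cellN N L, W X * ((‖Φ₁.ψ X‖₊ : ℝ≥0∞)) ^ 2) +
        (periodicEnergy v Φ₂ + ∫⁻ X in cellN N L, W X * ((‖Φ₂.ψ X‖₊ : ℝ≥0∞)) ^ 2))
    {η : ℝ} (hη : 0 < η) (Φ Φ' : PeriodicTrialState N L)
    (hΦ : periodicEnergy v Φ + ∫⁻ X in cellN N L, W X * ((‖Φ.ψ X‖₊ : ℝ≥0∞)) ^ 2 ≤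
      E + ENNReal.ofReal (γ * η / 16))
    (hΦ' : periodicEnergy v Φ' + ∫⁻ X in cellN N L, W X * ((‖Φ'.ψ X‖₊ : ℝ≥0∞)) ^ 2 ≤
      E + ENNReal.ofReal (γ * η / 16)) :
    ∃ θ : ℝ, ∫ X in cellN N L, ‖Φ.ψ X - Complex.exp (θ * Complex.I) * Φ'.ψ X‖ ^ 2 ≤ η := by
  -- the phase aligning `Φ'` with `Φ`
  set s : ℂ := ∫ X in cellN N L, conj (Φ'.ψ X) * Φ.ψ X with hs
  set c : ℂ := Complex.exp (↑(Complex.arg s) * Complex.I) with hc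
  have hc1 : ‖c‖ = 1 := Complex.norm_exp_ofReal_mul_I _
  have hc2 : ((‖c‖₊ : ℝ≥0∞)) ^ 2 = 1 := by
    rw [ennnorm_sq_eq_ofReal, hc1, one_pow, ENNReal.ofReal_one]
  have hcc : conj c * c = 1 := by
    rw [Complex.conj_mul', hc1, Complex.ofReal_one, one_pow]
  have hs_polar : s = ↑‖s‖ * c := by rw [hc]; exact (Complex.norm_mul_exp_arg_mul_I s).symm
  have hcs : conj c * s = (‖s‖ : ℂ) := by
    calc conj c * s = conj c * (↑‖s‖ * c) := by rw [← hs_polar]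
      _ = ↑‖s‖ * (conj c * c) := by ring
      _ = ↑‖s‖ := by rw [hcc, mul_one]
  -- regularity of `Φ`, `cΦ'`, `u = Φ + cΦ'`, `w = Φ - cΦ'`
  have hΦc : Continuous Φ.ψ := Φ.contDiff.continuous
  have hΦ'c : Continuous Φ'.ψ := Φ'.contDiff.continuous
  have hcΦ' : ContDiff ℝ 1 (fun X => c * Φ'.ψ X) := contDiff_const.mul Φ'.contDiff
  have hCu : ContDiff ℝ 1 (fun X => Φ.ψ X + c * Φ'.ψ X) := Φ.contDiff.add hcΦ'
  have hCw : ContDiff ℝ 1 (fun X => Φ.ψ X - c * Φ'.ψ X) := Φ.contDiff.sub hcΦ'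
  have hper_u : ∀ (X : Config N) (i : Fin N) (k : Fin 3),
      Φ.ψ (X + Pi.single i (EuclideanSpace.single k L)) +
          c * Φ'.ψ (X + Pi.single i (EuclideanSpace.single k L)) = Φ.ψ X + c * Φ'.ψ X :=
    fun X i k => by rw [Φ.periodic, Φ'.periodic]
  have hper_w : ∀ (X : Config N) (i : Fin N) (k : Fin 3),
      Φ.ψ (X + Pi.single i (EuclideanSpace.single k L)) -
          c * Φ'.ψ (X + Pi.single i (EuclideanSpace.single k L)) = Φ.ψ X - c * Φ'.ψ X :=
    fun X i k => by rw [Φ.periodic, Φ'.periodic]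
  have hsymm_u : ∀ (σ : Equiv.Perm (Fin N)) (X : Config N),
      Φ.ψ (X ∘ σ) + c * Φ'.ψ (X ∘ σ) = Φ.ψ X + c * Φ'.ψ X :=
    fun σ X => by rw [Φ.symm, Φ'.symm]
  have hsymm_w : ∀ (σ : Equiv.Perm (Fin N)) (X : Config N),
      Φ.ψ (X ∘ σ) - c * Φ'.ψ (X ∘ σ) = Φ.ψ X - c * Φ'.ψ X :=
    fun σ X => by rw [Φ.symm, Φ'.symm]
  -- `‖cΦ'‖² = 1`, `q_W(cΦ') = q_W(Φ')`
  have hnΦ'' : ∫⁻ X in cellN N L, ((‖c * Φ'.ψ X‖₊ : ℝ≥0∞)) ^ 2 = 1 := by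
    rw [lintegral_cellN_sq_const_mul, Φ'.norm_eq, mul_one, hc2]
  have hEΦ'' : (∫⁻ X in cellN N L, kineticDensity (fun Y => c * Φ'.ψ Y) X +
        periodicInteraction v L X * ((‖c * Φ'.ψ X‖₊ : ℝ≥0∞)) ^ 2) +
      (∫⁻ X in cellN N L, W X * ((‖c * Φ'.ψ X‖₊ : ℝ≥0∞)) ^ 2) =
      periodicEnergy v Φ' + ∫⁻ X in cellN N L, W X * ((‖Φ'.ψ X‖₊ : ℝ≥0∞)) ^ 2 := by
    rw [lintegral_periodicEnergy_const_mul v L c Φ'.contDiff, lintegral_weight_sq_const_mul, hc2,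
      one_mul, one_mul]
    rfl
  -- (F1) `‖u‖² + ‖w‖² = 4`
  have hpm : (∫⁻ X in cellN N L, ((‖Φ.ψ X + c * Φ'.ψ X‖₊ : ℝ≥0∞)) ^ 2) +
      (∫⁻ X in cellN N L, ((‖Φ.ψ X - c * Φ'.ψ X‖₊ : ℝ≥0∞)) ^ 2) = 4 := by
    rw [lintegral_cellN_sq_add_add_sub L hΦc hcΦ'.continuous, Φ.norm_eq, hnΦ'']
    norm_num
  -- (F2) `q_W(u) + q_W(w) ≤ 4E + 4δ`
  have hab : ((∫⁻ X in cellN N L, kineticDensity (fun Y => Φ.ψ Y + c * Φ'.ψ Y) X +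
        periodicInteraction v L X * ((‖Φ.ψ X + c * Φ'.ψ X‖₊ : ℝ≥0∞)) ^ 2) +
        ∫⁻ X in cellN N L, W X * ((‖Φ.ψ X + c * Φ'.ψ X‖₊ : ℝ≥0∞)) ^ 2) +
      ((∫⁻ X in cellN N L, kineticDensity (fun Y => Φ.ψ Y - c * Φ'.ψ Y) X +
        periodicInteraction v L X * ((‖Φ.ψ X - c * Φ'.ψ X‖₊ : ℝ≥0∞)) ^ 2) +
        ∫⁻ X in cellN N L, W X * ((‖Φ.ψ X - c * Φ'.ψ X‖₊ : ℝ≥0∞)) ^ 2) ≤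
      4 * E + 4 * ENNReal.ofReal (γ * η / 16) := by
    rw [lintegral_weightedEnergy_add_add_sub hv hW L Φ.contDiff hcΦ', hEΦ'']
    calc 2 * (periodicEnergy v Φ + ∫⁻ X in cellN N L, W X * ((‖Φ.ψ X‖₊ : ℝ≥0∞)) ^ 2) +
          2 * (periodicEnergy v Φ' + ∫⁻ X in cellN N L, W X * ((‖Φ'.ψ X‖₊ : ℝ≥0∞)) ^ 2)
        ≤ 2 * (E + ENNReal.ofReal (γ * η / 16)) + 2 * (E + ENNReal.ofReal (γ * η / 16)) := by
          gcongr
      _ = _ := by ring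
  -- (F3) `u ⊥ w` in `L²(cell)`
  have hUW : ∫ X in cellN N L, conj (Φ.ψ X + c * Φ'.ψ X) * (Φ.ψ X - c * Φ'.ψ X) = 0 := by
    have hprod : (fun X => conj (Φ.ψ X + c * Φ'.ψ X) * (Φ.ψ X - c * Φ'.ψ X)) =
        fun X => (conj (Φ.ψ X) * Φ.ψ X - conj c * c * (conj (Φ'.ψ X) * Φ'.ψ X)) +
          (conj c * (conj (Φ'.ψ X) * Φ.ψ X) - conj (conj c * (conj (Φ'.ψ X) * Φ.ψ X))) := by
      funext X; simp only [map_mul, map_add, Complex.conj_conj]; ring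
    have hi1 : IntegrableOn (fun X => conj (Φ.ψ X) * Φ.ψ X) (cellN N L) :=
      integrableOn_cellN (hΦc.star.mul hΦc) L
    have hi4 : IntegrableOn (fun X => conj c * c * (conj (Φ'.ψ X) * Φ'.ψ X)) (cellN N L) :=
      integrableOn_cellN (continuous_const.mul (hΦ'c.star.mul hΦ'c)) L
    have hi3 : IntegrableOn (fun X => conj c * (conj (Φ'.ψ X) * Φ.ψ X)) (cellN N L) :=
      integrableOn_cellN (continuous_const.mul (hΦ'c.star.mul hΦc)) L
    have hi2 : IntegrableOn (fun X => conj (conj c * (conj (Φ'.ψ X) * Φ.ψ X))) (cellN N L) :=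
      integrableOn_cellN (continuous_const.mul (hΦ'c.star.mul hΦc)).star L
    have hi14 : IntegrableOn (fun X => conj (Φ.ψ X) * Φ.ψ X -
        conj c * c * (conj (Φ'.ψ X) * Φ'.ψ X)) (cellN N L) := hi1.sub hi4
    have hi32 : IntegrableOn (fun X => conj c * (conj (Φ'.ψ X) * Φ.ψ X) -
        conj (conj c * (conj (Φ'.ψ X) * Φ.ψ X))) (cellN N L) := hi3.sub hi2
    rw [hprod, integral_add hi14 hi32, integral_sub hi1 hi4, integral_sub hi3 hi2,
      integral_const_mul, integral_const_mul, integral_conj, integral_const_mul,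
      integral_cellN_conj_mul_self_trialState, integral_cellN_conj_mul_self_trialState, ← hs, hcs,
      hcc, Complex.conj_ofReal]
    ring
  -- weighted energies of the normalised states
  have hEnorm : ∀ (U : Config N → ℂ), ContDiff ℝ 1 U → ∀ (Ψ : PeriodicTrialState N L) (a : ℝ),
      (Ψ.ψ = fun X => (a : ℂ) * U X) →
      periodicEnergy v Ψ + ∫⁻ X in cellN N L, W X * ((‖Ψ.ψ X‖₊ : ℝ≥0∞)) ^ 2 =
        ((‖(a : ℂ)‖₊ : ℝ≥0∞)) ^ 2 * ((∫⁻ X in cellN N L, kineticDensity U X +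
          periodicInteraction v L X * ((‖U X‖₊ : ℝ≥0∞)) ^ 2) +
          ∫⁻ X in cellN N L, W X * ((‖U X‖₊ : ℝ≥0∞)) ^ 2) := by
    intro U hU Ψ a h
    have h1 : periodicEnergy v Ψ = ((‖(a : ℂ)‖₊ : ℝ≥0∞)) ^ 2 *
        ∫⁻ X in cellN N L, kineticDensity U X +
          periodicInteraction v L X * ((‖U X‖₊ : ℝ≥0∞)) ^ 2 := by
      unfold periodicEnergy
      rw [h]
      exact lintegral_periodicEnergy_const_mul v L (a : ℂ) hU
    have h2 : ∫⁻ X in cellN N L, W X * ((‖Ψ.ψ X‖₊ : ℝ≥0∞)) ^ 2 = ((‖(a : ℂ)‖₊ : ℝ≥0∞)) ^ 2 *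
        ∫⁻ X in cellN N L, W X * ((‖U X‖₊ : ℝ≥0∞)) ^ 2 := by
      rw [h]
      exact lintegral_weight_sq_const_mul W L (a : ℂ) U
    rw [h1, h2, mul_add]
  -- (F4) `E ‖u‖² ≤ q_W(u)` and `E ‖w‖² ≤ q_W(w)`
  have hFa : (∫⁻ X in cellN N L, ((‖Φ.ψ X + c * Φ'.ψ X‖₊ : ℝ≥0∞)) ^ 2) ≠ 0 →
      E * (∫⁻ X in cellN N L, ((‖Φ.ψ X + c * Φ'.ψ X‖₊ : ℝ≥0∞)) ^ 2) ≤
        (∫⁻ X in cellN N L, kineticDensity (fun Y => Φ.ψ Y + c * Φ'.ψ Y) X +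
          periodicInteraction v L X * ((‖Φ.ψ X + c * Φ'.ψ X‖₊ : ℝ≥0∞)) ^ 2) +
        ∫⁻ X in cellN N L, W X * ((‖Φ.ψ X + c * Φ'.ψ X‖₊ : ℝ≥0∞)) ^ 2 := by
    intro hp0
    have hp_top : (∫⁻ X in cellN N L, ((‖Φ.ψ X + c * Φ'.ψ X‖₊ : ℝ≥0∞)) ^ 2) ≠ ⊤ :=
      ne_top_of_le_ne_top (by norm_num) (hpm ▸ le_self_add)
    obtain ⟨û, a, hûψ, ha⟩ := exists_periodicTrialState_const_mul hCu hper_u hsymm_u hp0 hp_top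
    have hEu := hEnorm _ hCu û a hûψ
    rw [ha] at hEu
    calc _ ≤ (periodicEnergy v û + ∫⁻ X in cellN N L, W X * ((‖û.ψ X‖₊ : ℝ≥0∞)) ^ 2) * _ :=
        mul_le_mul' (hvar û) le_rfl
      _ = _ := by rw [hEu, mul_comm _⁻¹, mul_assoc, ENNReal.inv_mul_cancel hp0 hp_top, mul_one]
  have hFb : (∫⁻ X in cellN N L, ((‖Φ.ψ X - c * Φ'.ψ X‖₊ : ℝ≥0∞)) ^ 2) ≠ 0 →
      E * (∫⁻ X in cellN N L, ((‖Φ.ψ X - c * Φ'.ψ X‖₊ : ℝ≥0∞)) ^ 2) ≤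
        (∫⁻ X in cellN N L, kineticDensity (fun Y => Φ.ψ Y - c * Φ'.ψ Y) X +
          periodicInteraction v L X * ((‖Φ.ψ X - c * Φ'.ψ X‖₊ : ℝ≥0∞)) ^ 2) +
        ∫⁻ X in cellN N L, W X * ((‖Φ.ψ X - c * Φ'.ψ X‖₊ : ℝ≥0∞)) ^ 2 := by
    intro hm0
    have hm_top : (∫⁻ X in cellN N L, ((‖Φ.ψ X - c * Φ'.ψ X‖₊ : ℝ≥0∞)) ^ 2) ≠ ⊤ :=
      ne_top_of_le_ne_top (by norm_num) (hpm ▸ le_add_self)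
    obtain ⟨ŵ, b, hŵψ, hb⟩ := exists_periodicTrialState_const_mul hCw hper_w hsymm_w hm0 hm_top
    have hEw := hEnorm _ hCw ŵ b hŵψ
    rw [hb] at hEw
    calc _ ≤ (periodicEnergy v ŵ + ∫⁻ X in cellN N L, W X * ((‖ŵ.ψ X‖₊ : ℝ≥0∞)) ^ 2) * _ :=
        mul_le_mul' (hvar ŵ) le_rfl
      _ = _ := by rw [hEw, mul_comm _⁻¹, mul_assoc, ENNReal.inv_mul_cancel hm0 hm_top, mul_one]
  -- (F5) the Ky Fan gap tested on the orthogonal pair `û, ŵ`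
  have hF5 : (∫⁻ X in cellN N L, ((‖Φ.ψ X + c * Φ'.ψ X‖₊ : ℝ≥0∞)) ^ 2) ≠ 0 →
      (∫⁻ X in cellN N L, ((‖Φ.ψ X - c * Φ'.ψ X‖₊ : ℝ≥0∞)) ^ 2) ≠ 0 →
      2 * E + ENNReal.ofReal γ ≤
        (∫⁻ X in cellN N L, ((‖Φ.ψ X + c * Φ'.ψ X‖₊ : ℝ≥0∞)) ^ 2)⁻¹ *
          ((∫⁻ X in cellN N L, kineticDensity (fun Y => Φ.ψ Y + c * Φ'.ψ Y) X +
            periodicInteraction v L X * ((‖Φ.ψ X + c * Φ'.ψ X‖₊ : ℝ≥0∞)) ^ 2) +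
          ∫⁻ X in cellN N L, W X * ((‖Φ.ψ X + c * Φ'.ψ X‖₊ : ℝ≥0∞)) ^ 2) +
        (∫⁻ X in cellN N L, ((‖Φ.ψ X - c * Φ'.ψ X‖₊ : ℝ≥0∞)) ^ 2)⁻¹ *
          ((∫⁻ X in cellN N L, kineticDensity (fun Y => Φ.ψ Y - c * Φ'.ψ Y) X +
            periodicInteraction v L X * ((‖Φ.ψ X - c * Φ'.ψ X‖₊ : ℝ≥0∞)) ^ 2) +
          ∫⁻ X in cellN N L, W X * ((‖Φ.ψ X - c * Φ'.ψ X‖₊ : ℝ≥0∞)) ^ 2) := by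
    intro hp0 hm0
    have hp_top : (∫⁻ X in cellN N L, ((‖Φ.ψ X + c * Φ'.ψ X‖₊ : ℝ≥0∞)) ^ 2) ≠ ⊤ :=
      ne_top_of_le_ne_top (by norm_num) (hpm ▸ le_self_add)
    have hm_top : (∫⁻ X in cellN N L, ((‖Φ.ψ X - c * Φ'.ψ X‖₊ : ℝ≥0∞)) ^ 2) ≠ ⊤ :=
      ne_top_of_le_ne_top (by norm_num) (hpm ▸ le_add_self)
    obtain ⟨û, a, hûψ, ha⟩ := exists_periodicTrialState_const_mul hCu hper_u hsymm_u hp0 hp_top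
    obtain ⟨ŵ, b, hŵψ, hb⟩ := exists_periodicTrialState_const_mul hCw hper_w hsymm_w hm0 hm_top
    have hEu := hEnorm _ hCu û a hûψ
    rw [ha] at hEu
    have hEw := hEnorm _ hCw ŵ b hŵψ
    rw [hb] at hEw
    have horth : ∫ X in cellN N L, conj (û.ψ X) * ŵ.ψ X = 0 := by
      rw [hûψ, hŵψ]
      have h2 : (fun X => conj ((a : ℂ) * (Φ.ψ X + c * Φ'.ψ X)) * ((b : ℂ) * (Φ.ψ X - c * Φ'.ψ X))) =
          fun X => (conj (a : ℂ) * b) * (conj (Φ.ψ X + c * Φ'.ψ X) * (Φ.ψ X - c * Φ'.ψ X)) := by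
        funext X; simp only [map_mul]; ring
      rw [h2, integral_const_mul, hUW, mul_zero]
    calc 2 * E + ENNReal.ofReal γ
        ≤ (periodicEnergy v û + ∫⁻ X in cellN N L, W X * ((‖û.ψ X‖₊ : ℝ≥0∞)) ^ 2) +
          (periodicEnergy v ŵ + ∫⁻ X in cellN N L, W X * ((‖ŵ.ψ X‖₊ : ℝ≥0∞)) ^ 2) :=
          hgap û ŵ horth
      _ = _ := by rw [hEu, hEw]
  -- bookkeeping: `min(‖u‖², ‖w‖²) ≤ 8δ/γ = η/2`
  have key := min_toReal_le_of_kyFan_bookkeeping hγ (by positivity : (0 : ℝ) ≤ γ * η / 16) hE hpm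
    hab hFa hFb hF5
  have key' : min (∫⁻ X in cellN N L, ((‖Φ.ψ X + c * Φ'.ψ X‖₊ : ℝ≥0∞)) ^ 2).toReal
      (∫⁻ X in cellN N L, ((‖Φ.ψ X - c * Φ'.ψ X‖₊ : ℝ≥0∞)) ^ 2).toReal ≤ η := by
    calc _ ≤ 8 * (γ * η / 16) / γ := key
      _ = η / 2 := by field_simp; ring
      _ ≤ η := by linarith
  rcases le_total (∫⁻ X in cellN N L, ((‖Φ.ψ X - c * Φ'.ψ X‖₊ : ℝ≥0∞)) ^ 2).toReal
    (∫⁻ X in cellN N L, ((‖Φ.ψ X + c * Φ'.ψ X‖₊ : ℝ≥0∞)) ^ 2).toReal with h | h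
  · -- `w = Φ - cΦ'` is the small one: `θ = arg s`
    refine ⟨Complex.arg s, ?_⟩
    rw [← hc, integral_cellN_norm_sq_eq_toReal L (F := fun X => Φ.ψ X - c * Φ'.ψ X)
      (hΦc.sub hcΦ'.continuous)]
    exact (min_eq_right h ▸ key')
  · -- `u = Φ + cΦ'` is the small one: `θ = arg s + π`
    refine ⟨Complex.arg s + Real.pi, ?_⟩
    have hneg : Complex.exp (↑(Complex.arg s + Real.pi) * Complex.I) = -c := by
      rw [Complex.ofReal_add, add_mul, Complex.exp_add, Complex.exp_pi_mul_I, hc, mul_neg_one]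
    simp_rw [hneg, neg_mul, sub_neg_eq_add]
    rw [integral_cellN_norm_sq_eq_toReal L (F := fun X => Φ.ψ X + c * Φ'.ψ X)
      (hΦc.add hcΦ'.continuous)]
    exact (min_eq_left h ▸ key')

/-! ### Stub C1 -/

/-- **Stub C1 — clustering of pinned near-minimisers from a Ky Fan gap of the pinned form** (fixed
`(N, L)`, all measurable `v`, hard cores included). If the pinned infimum
`E_imp = impurityPeriodicGroundStateEnergy v N L 0` is finite and every `L²(cell^N)`-orthogonal pair of
periodic trial states costs `impurityPeriodicEnergy v 0 Φ₁ + impurityPeriodicEnergy v 0 Φ₂ ≥ 2E_imp + γ`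
(`γ > 0`), then for every `η > 0` there is `δ > 0` (namely `γη/16`) such that any two `δ`-near-minimisers
of the pinned form overlap: `1 - η ≤ |⟨Φ, Φ'⟩_{cell}|²`. The parallelogram-law argument of
`exists_phase_integral_norm_sub_sq_le_of_kyFanGap` run for the pinned form (its one-body term
`∫ (∑ⱼ v^per(xⱼ)) |Φ|²` obeys the same parallelogram and scaling laws: `exists_phase_of_weighted_kyFanGap`),
read through `ofReal_le_sq_nnnorm_integral_of_phase`. Registered stub of the reshaped `CloudMomentumAtom`
skeleton (lead c2). [cite: ReedSimonIV1978, Thm XIII.1–2 (min–max for the two lowest levels; Ky Fan form)] -/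
theorem stub_impurityClustering_of_gap :
    ∀ (v : ℝ → ℝ≥0∞), Measurable v → ∀ (N : ℕ) (L : ℝ),
      impurityPeriodicGroundStateEnergy v N L 0 ≠ ⊤ →
      ∀ γ : ℝ, 0 < γ →
        (∀ Φ₁ Φ₂ : PeriodicTrialState N L,
          ∫ X in cellN N L, conj (Φ₁.ψ X) * Φ₂.ψ X = 0 →
          2 * impurityPeriodicGroundStateEnergy v N L 0 + ENNReal.ofReal γ ≤
            impurityPeriodicEnergy v 0 Φ₁ + impurityPeriodicEnergy v 0 Φ₂) →
        ∀ η : ℝ, 0 < η → ∃ δ : ℝ≥0∞, 0 < δ ∧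
          ∀ Φ Φ' : PeriodicTrialState N L,
            impurityPeriodicEnergy v 0 Φ ≤ impurityPeriodicGroundStateEnergy v N L 0 + δ →
            impurityPeriodicEnergy v 0 Φ' ≤ impurityPeriodicGroundStateEnergy v N L 0 + δ →
            ENNReal.ofReal (1 - η) ≤
              (‖∫ X in cellN N L, conj (Φ.ψ X) * Φ'.ψ X‖₊ : ℝ≥0∞) ^ 2 := by
  intro v hv N L hE γ hγ hgap η hη
  refine ⟨ENNReal.ofReal (γ * η / 16), ENNReal.ofReal_pos.2 (by positivity), fun Φ Φ' hΦ hΦ' => ?_⟩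
  have hW : Measurable fun X : Config N => ∑ j : Fin N, periodizedPotential v L (X j - 0) :=
    Finset.measurable_sum _ fun j _ =>
      (measurable_periodizedPotential hv L).comp ((measurable_pi_apply j).sub_const _)
  obtain ⟨θ, hθ⟩ := exists_phase_of_weighted_kyFanGap (L := L) hv hW hE hγ
    (fun Ψ => impurityPeriodicGroundStateEnergy_le v 0 Ψ) hgap hη Φ Φ' hΦ hΦ'
  exact ofReal_le_sq_nnnorm_integral_of_phase Φ Φ' hθ

end Summit.AtomisticToContinuum.BoseEinsteinCondensation.Cruxes.CloudMomentumAtom.Birth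

end
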